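import Literature.Analysis.FunctionSpaces.PV1Coding
import Literature.Analysis.FunctionSpaces.PVStrictForms
import HarnessLib

/-!
# Models of `PV₁`: open forms of sharply bounded formulas and witness forms of `Σᵇ₁(PV)` formulas

Sixth layer of the toolkit for `S2PV_one_isConservativeOver_PV1` (Buss 1986, §6.1, §2.7 and
Ch. 6; Krajíček 1995, §5.3, Lemma 7.2.2 and Thm. 7.6.3; Avigad 2002, §4): the `PV₁` analogue of
`PVStrictForms.lean` (which treats formulas of Buss's language in models of `trueUnivPV`).

## Part I. Sharply bounded `L(PV)`-formulas are open, uniformly over `PV₁`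

* `ModelPredPV n`, `InPV1`, `InSatPV1` — predicates on `n`-tuples uniformly in an
  `L(PV)`-structure, and their validity in all (Herbrand-saturated) models of `PV₁`;
* `HasOpenFormPV A`; `PV1.papp_charSym` (characteristic symbols in models of `PV₁`);
  `HasOpenFormPV.ballLELen` (a sharply bounded universal quantifier over an open form is open, by
  the search symbol `lsearch` of `PV1Coding.lean`); **`hasOpenFormPV_of_isSharplyBoundedPV`**
  (Buss 1986, §6.1: in `PV₁` sharply bounded quantifiers are eliminable).

## Part II. Witness forms

Every `Σᵇ₁(PV)` formula `θ(x̄)` in context variables gets a **witness form**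
`∃ w ≤ T(x̄) E(x̄, w)` with `E` open in `L(PV)` and `T` a symbol of the monotone fragment, which
is *sound in every model of `PV₁`* (`w ≤ T(x̄) ∧ E(x̄, w) → θ(x̄)`; Krajíček 1995, L. 7.2.2 (b):
`PV₁ ⊢ Witness → A`) and *complete in every Herbrand-saturated model of `PV₁`*
(`θ(x̄) → ∃ w ≤ T(x̄) E(x̄, w)`); dually for `Πᵇ₁(PV)` (`HasSigmaFormPV`, `HasPiFormPV`,
**`hasSigmaFormPV_of_isSigmabPV_one`**).  The cases: sharply bounded (open form, dummy witness);
`Π → Σ` (sum of bounds) and `Σ → Π` (pairing); `∃ y ≤ t` and `∀ y ≤ t` (pairing `⟨w, y⟩_t`, with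
the *monotone* bound `bound t` of the arbitrary `L(PV)` bounding term `t`); and the sharply
bounded quantifiers `∀ z ≤ |t|` over `Σ` / `∃ z ≤ |t|` over `Π`, where sharply bounded collection
is provided by Herbrand saturation (a Skolem symbol, `PV1.exists_skolem_sym_ctx₁`) and the tables
of `PV1Coding.lean` (`PV1.exists_table`) — Buss 1986, §2.7 (`BB Σᵇ₁`); Krajíček 1995, proof of
Thm. 7.6.3.

## References

* S. R. Buss, *Bounded Arithmetic*, Bibliopolis 1986, §2.7, §6.1, Ch. 6.
* J. Krajíček, *Bounded Arithmetic, Propositional Logic and Complexity Theory*, CUP 1995, §5.3,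
  Lemma 7.2.2, Thm. 7.6.3.
* J. Avigad, *Saturated models of universal theories*, APAL 118 (2002), §4.
* S. A. Cook, *Feasibly constructive proofs and the propositional calculus*, STOC 1975, §2.

## Design choices

* Formulas are in "context variables" form `Language.pv.BoundedFormula Empty n`, as in
  `PVStrictForms.lean`; `PVStrictForms.lean` is imported only for the definition `charSym`.
* Bounds are *symbols* `T : PVFun n` with `T.IsMono`, applied as `papp T xs`, rather than terms
  of Buss's language: the bound of `∃ y ≤ t` involves `PVFun.bound (symT t)`.
-/

namespace Literature.Analysis.FunctionSpaces

open FirstOrder FirstOrder.Language FirstOrder.Language.BoundedFormula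
open Literature.Computability.MetaComplexity Literature.Computability.MetaComplexity.BASICModel
open Literature.ModelTheory.UniversalTheories

attribute [local instance] pvReduct isExpansionOn_pvReduct

/-! # Part I. Open forms -/

/-! ## Predicates uniform in the model -/

section Uniform

variable {n : ℕ}

/-- A predicate on `n`-tuples in every `L(PV)`-structure. [folklore] -/
def ModelPredPV (n : ℕ) : Type 1 :=
  ∀ (K : Type) [Language.pv.Structure K], (Fin n → K) → Prop

/-- The predicate defined by an `L(PV)`-formula in context variables. [folklore] -/
def predOfPV (θ : Language.pv.BoundedFormula Empty n) : ModelPredPV n :=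
  fun K _ xs => θ.Realize (default : Empty → K) xs

/-- `P` holds of all tuples in all models of `PV₁`. [folklore] -/
def InPV1 (P : ModelPredPV n) : Prop :=
  ∀ (K : Type) [Language.pv.Structure K], K ⊨ PV1 → ∀ xs : Fin n → K, P K xs

/-- `P` holds of all tuples in all Herbrand-saturated models of `PV₁`. [folklore] -/
def InSatPV1 (P : ModelPredPV n) : Prop :=
  ∀ (K : Type) [Language.pv.Structure K], K ⊨ PV1 → IsHerbrandSaturated Language.pv K →
    ∀ xs : Fin n → K, P K xs

/-- What holds in all models of `PV₁` holds in the Herbrand-saturated ones. [folklore] -/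
theorem InPV1.inSatPV1 {P : ModelPredPV n} (h : InPV1 P) : InSatPV1 P :=
  fun K _ hK _ xs => h K hK xs

/-- **Uniform open form over `PV₁`**: an open `L(PV)`-formula `π` equivalent to `A` in every model
of `PV₁`. [folklore] -/
def HasOpenFormPV (A : ModelPredPV n) : Prop :=
  ∃ π : Language.pv.BoundedFormula Empty n, π.IsQF ∧
    InPV1 fun K _ xs => A K xs ↔ π.Realize (default : Empty → K) xs

/-- Transport of open forms along uniform equivalence. [folklore] -/
theorem HasOpenFormPV.of_iff {A B : ModelPredPV n} (h : HasOpenFormPV A)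
    (hAB : InPV1 fun K _ xs => A K xs ↔ B K xs) : HasOpenFormPV B := by
  obtain ⟨π, hπ, e⟩ := h
  exact ⟨π, hπ, fun K _ hK xs => (hAB K hK xs).symm.trans (e K hK xs)⟩

/-- Open formulas are their own open forms. [folklore] -/
theorem hasOpenFormPV_of_isQF {θ : Language.pv.BoundedFormula Empty n} (hθ : θ.IsQF) :
    HasOpenFormPV (predOfPV θ) :=
  ⟨θ, hθ, fun _ _ _ _ => Iff.rfl⟩

/-- Open forms are closed under implication. [folklore] -/
theorem HasOpenFormPV.imp {A B : ModelPredPV n} (hA : HasOpenFormPV A) (hB : HasOpenFormPV B) :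
    HasOpenFormPV fun K _ xs => A K xs → B K xs := by
  obtain ⟨π₁, hπ₁, e₁⟩ := hA
  obtain ⟨π₂, hπ₂, e₂⟩ := hB
  exact ⟨π₁.imp π₂, hπ₁.imp hπ₂, fun K _ hK xs =>
    (imp_congr (e₁ K hK xs) (e₂ K hK xs)).trans realize_imp.symm⟩

/-- Open forms are closed under negation. [folklore] -/
theorem HasOpenFormPV.not {A : ModelPredPV n} (hA : HasOpenFormPV A) :
    HasOpenFormPV fun K _ xs => ¬ A K xs := by
  obtain ⟨π, hπ, e⟩ := hA
  exact ⟨∼π, hπ.not, fun K _ hK xs => (not_congr (e K hK xs)).trans realize_not.symm⟩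

/-- Open forms are closed under conjunction. [folklore] -/
theorem HasOpenFormPV.and {A B : ModelPredPV n} (hA : HasOpenFormPV A) (hB : HasOpenFormPV B) :
    HasOpenFormPV fun K _ xs => A K xs ∧ B K xs := by
  obtain ⟨π₁, hπ₁, e₁⟩ := hA
  obtain ⟨π₂, hπ₂, e₂⟩ := hB
  exact ⟨π₁ ⊓ π₂, hπ₁.inf hπ₂, fun K _ hK xs =>
    (and_congr (e₁ K hK xs) (e₂ K hK xs)).trans (realize_inf (φ := π₁) (ψ := π₂)).symm⟩

end Uniform

/-! ## Characteristic symbols and sharply bounded quantifiers in models of `PV₁` -/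

namespace PV1

variable {K : Type} [Language.pv.Structure K] [hKB : K ⊨ BASIC] {m n : ℕ}

/-- **Characteristic symbols in a model of `PV₁`.** For open `π`: `charSym π (x̄) = 1 ↔ π(x̄)`
and `charSym π (x̄) ∈ {0, 1}`. [cite: Krajicek1995, §5.3] -/
theorem papp_charSym (hM : K ⊨ PV1) {π : Language.pv.BoundedFormula Empty m}
    (hπ : π.IsQF) (xs : Fin m → K) :
    (papp (charSym π) xs = 1 ↔ π.Realize default xs) ∧
      (papp (charSym π) xs = 0 ∨ papp (charSym π) xs = 1) := by
  have h := realize_charTerm hM hπ (default : Empty → K) xs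
  have e : papp (charSym π) xs = (charTerm π).realize (Sum.elim default xs) := by
    rw [charSym, papp_termSym (model_PVdef_of_model_PV1 hM), Term.realize_relabel]
    congr 1
    funext a; rcases a with a | j
    · exact a.elim
    · rfl
  rw [e]
  exact h

/-- **A sharply bounded universal quantifier over a `0/1`-valued symbol is open** in a model of
`PV₁`: `(∀ z ≤ |u|, G(ȳ, z) = 1) ↔ ¬ lsearch G (ȳ, u) ≤ |u|`. [cite: Buss1986, §6.1] -/
theorem forall_le_len_iff (hM : K ⊨ PV1) (G : PVFun (m + 1)) (ys : Fin m → K) (u : K)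
    (h01 : ∀ z, papp G (Fin.snoc ys z) = 0 ∨ papp G (Fin.snoc ys z) = 1) :
    (∀ z, z ≤ mLen u → papp G (Fin.snoc ys z) = 1) ↔
      ¬ papp (PVFun.lsearch G) (Fin.snoc ys u) ≤ mLen u := by
  rw [← exists_le_len_iff_lsearch_le hM G ys u]
  constructor
  · rintro hall ⟨i, hi, hG⟩
    have h1 := hall i hi
    rw [hG] at h1
    exact zero_ne_one h1
  · intro hne z hz
    rcases h01 z with h0 | h1
    · exact absurd ⟨z, hz, h0⟩ hne
    · exact h1

end PV1

/-! ## Sharply bounded formulas have open forms over `PV₁` -/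

section Open

variable {n : ℕ}

/-- **A sharply bounded universal quantifier over an open form is open** over `PV₁`: with `π₁`
an open form of `A(x̄, ·)` and `G = charSym π₁`, the predicate `∀ a ≤ |t(x̄)| A(x̄, a)` is
`¬ lsearch G (x̄, t(x̄)) ≤ |t(x̄)|` (Buss 1986, §6.1). [cite: Buss1986, §6.1] -/
theorem HasOpenFormPV.ballLELen (t : Language.pv.Term (Empty ⊕ Fin n)) {A : ModelPredPV (n + 1)}
    (hA : HasOpenFormPV A) :
    HasOpenFormPV fun K _ xs => ∀ a : K, MLe a (mLen (t.realize (Sum.elim default xs))) →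
      A K (Fin.snoc xs a) := by
  obtain ⟨π₁, hπ₁, e₁⟩ := hA
  let G : PVFun (n + 1) := charSym π₁
  let lsT : Language.pv.Term (Empty ⊕ Fin n) :=
    Term.func (PVFun.lsearch G) (Fin.snoc (fun i => cv i) t)
  let π : Language.pv.BoundedFormula Empty n := ∼(Term.le lsT (pvLen t))
  refine ⟨π, (IsAtomic.rel _ _).isQF.not, fun K _ hK xs => ?_⟩
  dsimp only
  haveI : K ⊨ BASIC := model_BASIC_of_model_PV1 hK
  set u : K := t.realize (Sum.elim default xs) with hu
  have h01 : ∀ z : K, papp G (Fin.snoc xs z) = 0 ∨ papp G (Fin.snoc xs z) = 1 :=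
    fun z => (PV1.papp_charSym hK hπ₁ (Fin.snoc xs z)).2
  have hsem : π.Realize (default : Empty → K) xs ↔
      ¬ papp (PVFun.lsearch G) (Fin.snoc xs u) ≤ mLen u := by
    simp only [π, lsT, realize_not, realize_pvle, Term.realize, QSym.realize_snoc_terms,
      Sum.elim_inr, realize_pvLen', hu]
  rw [hsem, ← PV1.forall_le_len_iff hK G xs u h01]
  exact forall_congr' fun a => imp_congr (mLe_iff _ _)
    ((e₁ K hK (Fin.snoc xs a)).trans (PV1.papp_charSym hK hπ₁ (Fin.snoc xs a)).1.symm)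

/-- **A sharply bounded existential quantifier over an open form is open** over `PV₁`.
[cite: Buss1986, §6.1] -/
theorem HasOpenFormPV.bexLELen (t : Language.pv.Term (Empty ⊕ Fin n)) {A : ModelPredPV (n + 1)}
    (hA : HasOpenFormPV A) :
    HasOpenFormPV fun K _ xs => ∃ a : K, MLe a (mLen (t.realize (Sum.elim default xs))) ∧
      A K (Fin.snoc xs a) := by
  refine ((hA.not.ballLELen t).not).of_iff fun K _ _ xs => ?_
  dsimp only
  push Not
  rfl

/-- **Sharply bounded `L(PV)`-formulas have open forms over `PV₁`** (Buss 1986, §6.1; by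
induction on the generation of the formula). [cite: Buss1986, §6.1] -/
theorem hasOpenFormPV_of_isSharplyBoundedPV {θ : Language.pv.BoundedFormula Empty n}
    (h : IsSharplyBoundedPV θ) : HasOpenFormPV (predOfPV θ) := by
  induction h with
  | of_isQF h => exact hasOpenFormPV_of_isQF h
  | imp _ _ ih₁ ih₂ =>
    exact (ih₁.imp ih₂).of_iff fun K _ _ xs => by simp [predOfPV]
  | ballLELenPV t _ ih =>
    refine (ih.ballLELen t).of_iff fun K _ hK xs => ?_
    simp only [predOfPV, ballLELenPV, realize_ballLE_pv', realize_pvLen']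
  | bexLELenPV t _ ih =>
    refine (ih.bexLELen t).of_iff fun K _ hK xs => ?_
    simp only [predOfPV, bexLELenPV, realize_bexLE_pv', realize_pvLen']

end Open


/-! # Part II. Witness forms -/

/-! ## Term plumbing -/

section Terms

variable {n : ℕ}

/-- A symbol applied to the context `x̄`, as a term in the context `(x̄, w)`. [folklore] -/
def upSym (T : PVFun n) : Language.pv.Term (Empty ⊕ Fin (n + 1)) :=
  Term.func T fun i => cv (Fin.castSucc i)

/-- A symbol applied to the context `x̄`, as a term in the context `(x̄, a, b)`. [folklore] -/
def upSym2 (T : PVFun n) : Language.pv.Term (Empty ⊕ Fin (n + 2)) :=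
  Term.func T fun i => cv (Fin.castSucc (Fin.castSucc i))

/-- A term lifted from the context `x̄` to `(x̄, w)`. [folklore] -/
def liftT1 (t : Language.pv.Term (Empty ⊕ Fin n)) : Language.pv.Term (Empty ⊕ Fin (n + 1)) :=
  t.relabel (Sum.map id Fin.castSucc)

/-- A term lifted from the context `x̄` to `(x̄, a, b)`. [folklore] -/
def liftT2 (t : Language.pv.Term (Empty ⊕ Fin n)) : Language.pv.Term (Empty ⊕ Fin (n + 2)) :=
  t.relabel (Sum.map id (Fin.castSucc ∘ Fin.castSucc))

/-- The symbol of a term in context variables. [folklore] -/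
def symT (t : Language.pv.Term (Empty ⊕ Fin n)) : PVFun n :=
  termSym (t.relabel (Sum.elim Empty.elim id))

variable {K : Type} [Language.pv.Structure K]

/-- Semantics of `upSym`. [folklore] -/
@[simp] theorem realize_upSym (T : PVFun n) (xs : Fin n → K) (w : K) :
    (upSym T).realize (Sum.elim default (Fin.snoc xs w)) = papp T xs := by
  rw [upSym, Term.realize]; congr 1; funext i; simp

/-- Semantics of `upSym2`. [folklore] -/
@[simp] theorem realize_upSym2 (T : PVFun n) (xs : Fin n → K) (a b : K) :
    (upSym2 T).realize (Sum.elim default (Fin.snoc (Fin.snoc xs a) b)) = papp T xs := by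
  rw [upSym2, Term.realize]; congr 1; funext i; simp

/-- Semantics of `liftT1`. [folklore] -/
@[simp] theorem realize_liftT1 (t : Language.pv.Term (Empty ⊕ Fin n)) (xs : Fin n → K) (w : K) :
    (liftT1 t).realize (Sum.elim default (Fin.snoc xs w)) = t.realize (Sum.elim default xs) := by
  rw [liftT1, Term.realize_relabel, Sum.elim_comp_map, Function.comp_id]
  congr 1; funext a; rcases a with a | j
  · exact a.elim
  · simp

/-- Semantics of `liftT2`. [folklore] -/
@[simp] theorem realize_liftT2 (t : Language.pv.Term (Empty ⊕ Fin n)) (xs : Fin n → K) (a b : K) :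
    (liftT2 t).realize (Sum.elim default (Fin.snoc (Fin.snoc xs a) b)) =
      t.realize (Sum.elim default xs) := by
  rw [liftT2, Term.realize_relabel, Sum.elim_comp_map, Function.comp_id]
  congr 1; funext c; rcases c with c | j
  · exact c.elim
  · simp

/-- Semantics of `symT` in a model of `PVdef`. [folklore] -/
theorem PV1.papp_symT (hD : K ⊨ PVdef) (t : Language.pv.Term (Empty ⊕ Fin n)) (xs : Fin n → K) :
    papp (symT t) xs = t.realize (Sum.elim default xs) := by
  rw [symT, PV1.papp_termSym hD, Term.realize_relabel]
  congr 1; funext a; rcases a with a | j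
  · exact a.elim
  · rfl

/-- Realizing the context `(x̄, f, g)` of terms in the context `(x̄, p)`. [folklore] -/
theorem realize_snocCtx2' (f g : Language.pv.Term (Empty ⊕ Fin (n + 1))) (xs : Fin n → K) (p : K) :
    (fun i => Term.realize (Sum.elim default (Fin.snoc xs p))
      ((Fin.snoc (Fin.snoc (fun i : Fin n =>
        (cv (Fin.castSucc i) : Language.pv.Term (Empty ⊕ Fin (n + 1)))) f) g :
        Fin (n + 2) → Language.pv.Term (Empty ⊕ Fin (n + 1))) i)) =
      Fin.snoc (Fin.snoc xs (f.realize (Sum.elim default (Fin.snoc xs p))))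
        (g.realize (Sum.elim default (Fin.snoc xs p))) := by
  funext i
  cases i using Fin.lastCases with
  | last => simp
  | cast i =>
    cases i using Fin.lastCases with
    | last => simp
    | cast i => simp

end Terms

/-! ## Monotonicity bookkeeping -/

namespace PVFun

variable {n : ℕ}

/-- `one'` lies in the monotone fragment. [folklore] -/
theorem isMono_one' : (one' : PVFun n).IsMono :=
  IsMono.comp (IsMono.bit true) fun i => by
    fin_cases i; exact IsMono.comp IsMono.zero fun j => Fin.elim0 j

/-- `sh` lies in the monotone fragment. [folklore] -/
theorem isMono_sh : sh.IsMono := by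
  refine IsMono.comp IsMono.mul fun i => ?_
  fin_cases i
  · exact IsMono.proj _
  · refine IsMono.comp IsMono.smash fun j => ?_
    fin_cases j
    · exact isMono_one'
    · exact IsMono.proj _

/-- `pairF` lies in the monotone fragment. [folklore] -/
theorem isMono_pairF : pairF.IsMono := by
  refine IsMono.comp IsMono.add fun i => ?_
  fin_cases i
  · refine IsMono.comp isMono_sh fun j => ?_
    fin_cases j <;> exact IsMono.proj _
  · exact IsMono.proj _

/-- A monotone `(n+1)`-ary symbol applied to `(x̄, B x̄)` with `B` monotone is monotone. [folklore] -/
theorem IsMono.snocComp {T : PVFun (n + 1)} {B : PVFun n} (hT : T.IsMono) (hB : B.IsMono) :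
    (PVFun.comp T (Fin.snoc (fun i => PVFun.proj i) B)).IsMono :=
  IsMono.comp hT fun i => by
    cases i using Fin.lastCases with
    | last => simpa using hB
    | cast i => simpa using IsMono.proj i

end PVFun

/-! ## Witness forms -/

section Forms

variable {n : ℕ}

/-- **Witness (`Σ`) form over `PV₁`** of a predicate: an open `E(x̄, w)` and a monotone bounding
symbol `T` with `w ≤ T(x̄) ∧ E(x̄, w) → A(x̄)` in every model of `PV₁` (*soundness*;
Krajíček 1995, L. 7.2.2 (b)) and `A(x̄) → ∃ w ≤ T(x̄) E(x̄, w)` in every Herbrand-saturated model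
of `PV₁` (*completeness*). [cite: Krajicek1995, Lemma 7.2.2] -/
def HasSigmaFormPV (A : ModelPredPV n) : Prop :=
  ∃ (E : Language.pv.BoundedFormula Empty (n + 1)) (T : PVFun n), E.IsQF ∧ T.IsMono ∧
    InPV1 (fun K _ xs => ∀ w : K, MLe w (papp T xs) →
      E.Realize (default : Empty → K) (Fin.snoc xs w) → A K xs) ∧
    InSatPV1 (fun K _ xs => A K xs → ∃ w : K, MLe w (papp T xs) ∧
      E.Realize (default : Empty → K) (Fin.snoc xs w))

/-- **Counter-witness (`Π`) form over `PV₁`**: `A(x̄) → ∀ w ≤ T(x̄) U(x̄, w)` in every model of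
`PV₁`, and `(∀ w ≤ T(x̄) U(x̄, w)) → A(x̄)` in every Herbrand-saturated one. [cite: Krajicek1995, Lemma 7.2.2] -/
def HasPiFormPV (A : ModelPredPV n) : Prop :=
  ∃ (U : Language.pv.BoundedFormula Empty (n + 1)) (T : PVFun n), U.IsQF ∧ T.IsMono ∧
    InPV1 (fun K _ xs => A K xs → ∀ w : K, MLe w (papp T xs) →
      U.Realize (default : Empty → K) (Fin.snoc xs w)) ∧
    InSatPV1 (fun K _ xs => (∀ w : K, MLe w (papp T xs) →
      U.Realize (default : Empty → K) (Fin.snoc xs w)) → A K xs)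

/-- Transport of `Σ` forms along uniform equivalence. [folklore] -/
theorem HasSigmaFormPV.of_iff {A B : ModelPredPV n} (h : HasSigmaFormPV A)
    (hAB : InPV1 fun K _ xs => A K xs ↔ B K xs) : HasSigmaFormPV B := by
  obtain ⟨E, T, hE, hT, hs, hc⟩ := h
  exact ⟨E, T, hE, hT, fun K _ hK xs w hw h => (hAB K hK xs).1 (hs K hK xs w hw h),
    fun K _ hK hsat xs hB => hc K hK hsat xs ((hAB K hK xs).2 hB)⟩

/-- Transport of `Π` forms along uniform equivalence. [folklore] -/
theorem HasPiFormPV.of_iff {A B : ModelPredPV n} (h : HasPiFormPV A)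
    (hAB : InPV1 fun K _ xs => A K xs ↔ B K xs) : HasPiFormPV B := by
  obtain ⟨U, T, hU, hT, hs, hc⟩ := h
  exact ⟨U, T, hU, hT, fun K _ hK xs hB w hw => hs K hK xs ((hAB K hK xs).2 hB) w hw,
    fun K _ hK hsat xs h => (hAB K hK xs).1 (hc K hK hsat xs h)⟩

/-- **An open predicate has a `Σ` form** (dummy witness `w ≤ 0`). [folklore] -/
theorem HasOpenFormPV.hasSigmaFormPV {A : ModelPredPV n} (h : HasOpenFormPV A) :
    HasSigmaFormPV A := by
  obtain ⟨π, hπ, e⟩ := h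
  refine ⟨substCtx π fun i => cv (Fin.castSucc i), PVFun.zero', isQF_substCtx hπ _,
    PVFun.IsMono.comp PVFun.IsMono.zero fun j => Fin.elim0 j,
    fun K _ hK xs w _ hw => ?_, fun K _ hK _ xs hA => ?_⟩
  · rw [realize_substCtx] at hw
    simp only [Term.realize, Sum.elim_inr, Fin.snoc_castSucc] at hw
    exact (e K hK xs).2 hw
  · haveI : K ⊨ BASIC := model_BASIC_of_model_PV1 hK
    refine ⟨0, ?_, ?_⟩
    · rw [mLe_iff, PV1.papp_zero' (model_PVdef_of_model_PV1 hK)]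
    rw [realize_substCtx]
    simp only [Term.realize, Sum.elim_inr, Fin.snoc_castSucc]
    exact (e K hK xs).1 hA

/-- **An open predicate has a `Π` form**. [folklore] -/
theorem HasOpenFormPV.hasPiFormPV {A : ModelPredPV n} (h : HasOpenFormPV A) : HasPiFormPV A := by
  obtain ⟨π, hπ, e⟩ := h
  refine ⟨substCtx π fun i => cv (Fin.castSucc i), PVFun.zero', isQF_substCtx hπ _,
    PVFun.IsMono.comp PVFun.IsMono.zero fun j => Fin.elim0 j,
    fun K _ hK xs hA w _ => ?_, fun K _ hK _ xs h => ?_⟩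
  · rw [realize_substCtx]
    simp only [Term.realize, Sum.elim_inr, Fin.snoc_castSucc]
    exact (e K hK xs).1 hA
  · haveI : K ⊨ BASIC := model_BASIC_of_model_PV1 hK
    have h0 := h 0 (by rw [mLe_iff, PV1.papp_zero' (model_PVdef_of_model_PV1 hK)])
    rw [realize_substCtx] at h0
    simp only [Term.realize, Sum.elim_inr, Fin.snoc_castSucc] at h0
    exact (e K hK xs).2 h0

/-- **`Π → Σ` is `Σ`** (bound: the sum of the bounds). [cite: Buss1986, §2.7] -/
theorem HasPiFormPV.imp_sigma {A B : ModelPredPV n} (hA : HasPiFormPV A) (hB : HasSigmaFormPV B) :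
    HasSigmaFormPV fun K _ xs => A K xs → B K xs := by
  obtain ⟨U₁, T₁, hU₁, hT₁, s₁, c₁⟩ := hA
  obtain ⟨E₂, T₂, hE₂, hT₂, s₂, c₂⟩ := hB
  let w : Language.pv.Term (Empty ⊕ Fin (n + 1)) := cv (Fin.last n)
  let E : Language.pv.BoundedFormula Empty (n + 1) :=
    (Term.le w (upSym T₁) ⊓ ∼U₁) ⊔ (Term.le w (upSym T₂) ⊓ E₂)
  have hE : E.IsQF :=
    (((IsAtomic.rel _ _).isQF.inf hU₁.not)).sup ((IsAtomic.rel _ _).isQF.inf hE₂)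
  refine ⟨E, PVFun.comp PVFun.add ![T₁, T₂], hE,
    PVFun.IsMono.comp PVFun.IsMono.add fun i => by fin_cases i <;> assumption,
    fun K _ hK xs v hv h => ?_, fun K _ hK hsat xs hAB => ?_⟩
  · haveI : K ⊨ BASIC := model_BASIC_of_model_PV1 hK
    intro hAx
    simp only [E, w, realize_sup, realize_inf, realize_not, realize_pvle, Term.realize_var,
      Sum.elim_inr, Fin.snoc_last, realize_upSym] at h
    rcases h with ⟨hv1, hnot⟩ | ⟨hv2, hE2⟩
    · exact absurd (s₁ K hK xs hAx v ((mLe_iff _ _).2 hv1)) hnot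
    · exact s₂ K hK xs v ((mLe_iff _ _).2 hv2) hE2
  · haveI : K ⊨ BASIC := model_BASIC_of_model_PV1 hK
    have hD := model_PVdef_of_model_PV1 hK
    have hT : papp (PVFun.comp PVFun.add ![T₁, T₂]) xs = papp T₁ xs + papp T₂ xs := by
      rw [PV1.papp_comp hD]
      have e : (fun i => papp ((![T₁, T₂] : Fin 2 → PVFun n) i) xs) = ![papp T₁ xs, papp T₂ xs] := by
        funext i; fin_cases i <;> rfl
      rw [e, papp_add, mAdd_eq]
    by_cases hAx : A K xs
    · obtain ⟨v, hv, hE2⟩ := c₂ K hK hsat xs (hAB hAx)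
      refine ⟨v, ?_, ?_⟩
      · rw [mLe_iff, hT]; exact ((mLe_iff _ _).1 hv).trans (le_add_left'' _ _)
      · simp only [E, w, realize_sup, realize_inf, realize_not, realize_pvle, Term.realize_var,
          Sum.elim_inr, Fin.snoc_last, realize_upSym]
        exact Or.inr ⟨(mLe_iff _ _).1 hv, hE2⟩
    · have hnot : ¬ ∀ v : K, MLe v (papp T₁ xs) → U₁.Realize default (Fin.snoc xs v) :=
        fun h => hAx (c₁ K hK hsat xs h)
      push Not at hnot
      obtain ⟨v, hv, hU⟩ := hnot
      refine ⟨v, ?_, ?_⟩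
      · rw [mLe_iff, hT]; exact ((mLe_iff _ _).1 hv).trans (le_add_right'' _ _)
      · simp only [E, w, realize_sup, realize_inf, realize_not, realize_pvle, Term.realize_var,
          Sum.elim_inr, Fin.snoc_last, realize_upSym]
        exact Or.inl ⟨(mLe_iff _ _).1 hv, hU⟩

variable {K : Type} [Language.pv.Structure K]

/-- The decoding terms `low (p, s)` and `mspLen (p, s)` of the last variable `p` relative to a
term `s` of the context `(x̄, p)`. [folklore] -/
def lowT (s : Language.pv.Term (Empty ⊕ Fin (n + 1))) : Language.pv.Term (Empty ⊕ Fin (n + 1)) :=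
  Term.func PVFun.low ![cv (Fin.last n), s]

/-- See `lowT`. [folklore] -/
def mspT (s : Language.pv.Term (Empty ⊕ Fin (n + 1))) : Language.pv.Term (Empty ⊕ Fin (n + 1)) :=
  Term.func PVFun.mspLen ![cv (Fin.last n), s]

/-- Semantics of `lowT`. [folklore] -/
@[simp] theorem realize_lowT (s : Language.pv.Term (Empty ⊕ Fin (n + 1))) (xs : Fin n → K) (p : K) :
    (lowT s).realize (Sum.elim default (Fin.snoc xs p)) =
      papp PVFun.low ![p, s.realize (Sum.elim default (Fin.snoc xs p))] := by
  rw [lowT, Term.realize]; congr 1; funext i; fin_cases i <;> simp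

/-- Semantics of `mspT`. [folklore] -/
@[simp] theorem realize_mspT (s : Language.pv.Term (Empty ⊕ Fin (n + 1))) (xs : Fin n → K) (p : K) :
    (mspT s).realize (Sum.elim default (Fin.snoc xs p)) =
      papp PVFun.mspLen ![p, s.realize (Sum.elim default (Fin.snoc xs p))] := by
  rw [mspT, Term.realize]; congr 1; funext i; fin_cases i <;> simp

/-- The pairing bound `⟨T₂, T₁⟩`-style symbol: `x̄ ↦ pairF (S x̄, R x̄, R x̄) = sh (S x̄, R x̄) + R x̄`.
[folklore] -/
def pairBoundSym (S R : PVFun n) : PVFun n := PVFun.comp PVFun.pairF ![S, R, R]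

/-- `pairBoundSym` is monotone for monotone arguments. [folklore] -/
theorem isMono_pairBoundSym {S R : PVFun n} (hS : S.IsMono) (hR : R.IsMono) :
    (pairBoundSym S R).IsMono :=
  PVFun.IsMono.comp PVFun.isMono_pairF fun i => by fin_cases i <;> assumption

/-- Semantics of `pairBoundSym`. [folklore] -/
theorem PV1.papp_pairBoundSym [K ⊨ BASIC] (hD : K ⊨ PVdef) (S R : PVFun n) (xs : Fin n → K) :
    papp (pairBoundSym S R) xs = papp PVFun.sh ![papp S xs, papp R xs] + papp R xs := by
  rw [pairBoundSym, PV1.papp_comp hD]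
  have e : (fun i => papp ((![S, R, R] : Fin 3 → PVFun n) i) xs) =
      ![papp S xs, papp R xs, papp R xs] := by
    funext i; fin_cases i <;> rfl
  rw [e, PV1.papp_pairF hD]

/-- A pair below the pairing bound. [folklore] -/
theorem PV1.pairF_le_pairBoundSym [K ⊨ BASIC] (hM : K ⊨ PV1) (S R : PVFun n) (xs : Fin n → K)
    {w y t : K} (hw : w ≤ papp S xs) (hy : y ≤ t) (ht : t ≤ papp R xs) :
    papp PVFun.pairF ![w, y, t] ≤ papp (pairBoundSym S R) xs := by
  have hD := model_PVdef_of_model_PV1 hM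
  rw [PV1.papp_pairBoundSym hD, PV1.papp_pairF hD, PV1.papp_sh hD, PV1.papp_sh hD]
  exact add_le_add (mul_le_mul'' hw (PV1.mSmash_le_mSmash hM le_rfl ht)) (hy.trans ht)

/-- **`Σ → Π` is `Π`** (the two counter-witnesses are paired). [cite: Buss1986, §2.7] -/
theorem HasSigmaFormPV.imp_pi {A B : ModelPredPV n} (hA : HasSigmaFormPV A) (hB : HasPiFormPV B) :
    HasPiFormPV fun K _ xs => A K xs → B K xs := by
  obtain ⟨E₁, T₁, hE₁, hT₁, s₁, c₁⟩ := hA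
  obtain ⟨U₂, T₂, hU₂, hT₂, s₂, c₂⟩ := hB
  -- `v = ⟨w', w⟩_{T₁ x̄}`: `w = low (v, T₁ x̄)` witnesses `A`, `w' = mspLen (v, T₁ x̄)` tests `B`
  let lo : Language.pv.Term (Empty ⊕ Fin (n + 1)) := lowT (upSym T₁)
  let hi : Language.pv.Term (Empty ⊕ Fin (n + 1)) := mspT (upSym T₁)
  let U : Language.pv.BoundedFormula Empty (n + 1) :=
    Term.le lo (upSym T₁) ⟹ (substCtx E₁ (Fin.snoc (fun i => cv (Fin.castSucc i)) lo) ⟹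
      (Term.le hi (upSym T₂) ⟹ substCtx U₂ (Fin.snoc (fun i => cv (Fin.castSucc i)) hi)))
  have hU : U.IsQF := (IsAtomic.rel _ _).isQF.imp ((isQF_substCtx hE₁ _).imp
    ((IsAtomic.rel _ _).isQF.imp (isQF_substCtx hU₂ _)))
  refine ⟨U, pairBoundSym T₂ T₁, hU, isMono_pairBoundSym hT₂ hT₁,
    fun K _ hK xs hAB v _ => ?_, fun K _ hK hsat xs h hAx => ?_⟩
  · haveI : K ⊨ BASIC := model_BASIC_of_model_PV1 hK
    simp only [U, lo, hi, realize_imp, realize_pvle, realize_lowT, realize_mspT, realize_upSym,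
      realize_substCtx, realize_snocCtx]
    intro hlo hE hhi
    have hA' : A K xs := s₁ K hK xs _ ((mLe_iff _ _).2 hlo) hE
    exact s₂ K hK xs (hAB hA') _ ((mLe_iff _ _).2 hhi)
  · haveI : K ⊨ BASIC := model_BASIC_of_model_PV1 hK
    obtain ⟨w, hw, hEw⟩ := c₁ K hK hsat xs hAx
    refine c₂ K hK hsat xs fun w' hw' => ?_
    rw [mLe_iff] at hw hw'
    let v : K := papp PVFun.pairF ![w', w, papp T₁ xs]
    have hv : MLe v (papp (pairBoundSym T₂ T₁) xs) :=
      (mLe_iff _ _).2 (PV1.pairF_le_pairBoundSym hK T₂ T₁ xs hw' hw le_rfl)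
    have hU := h v hv
    simp only [U, lo, hi, realize_imp, realize_pvle, realize_lowT, realize_mspT, realize_upSym,
      realize_substCtx, realize_snocCtx, v, PV1.low_pair hK _ hw, PV1.msp_pair hK _ hw] at hU
    exact hU hw hEw hw'

/-- The bound symbol of `∃ y ≤ t` / `∀ y ≤ t`: with `Bt = bound (symT t)`,
`x̄ ↦ ⟨T₁(x̄, Bt x̄), Bt x̄⟩`-bound. [folklore] -/
def bexBoundSym (t : Language.pv.Term (Empty ⊕ Fin n)) (T₁ : PVFun (n + 1)) : PVFun n :=
  pairBoundSym (PVFun.comp T₁ (Fin.snoc (fun i => PVFun.proj i) (PVFun.bound (symT t))))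
    (PVFun.bound (symT t))

/-- `bexBoundSym` is monotone. [folklore] -/
theorem isMono_bexBoundSym (t : Language.pv.Term (Empty ⊕ Fin n)) {T₁ : PVFun (n + 1)}
    (hT₁ : T₁.IsMono) : (bexBoundSym t T₁).IsMono :=
  isMono_pairBoundSym (hT₁.snocComp (PVFun.isMono_bound _)) (PVFun.isMono_bound _)

/-- The pair of a witness and a value below `t` is below `bexBoundSym`. [folklore] -/
theorem PV1.pairF_le_bexBoundSym [K ⊨ BASIC] (hM : K ⊨ PV1) (t : Language.pv.Term (Empty ⊕ Fin n))
    {T₁ : PVFun (n + 1)} (hT₁ : T₁.IsMono) (xs : Fin n → K) {w y : K}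
    (hy : y ≤ t.realize (Sum.elim default xs)) (hw : w ≤ papp T₁ (Fin.snoc xs y)) :
    papp PVFun.pairF ![w, y, t.realize (Sum.elim default xs)] ≤ papp (bexBoundSym t T₁) xs := by
  have hD := model_PVdef_of_model_PV1 hM
  have hBt : t.realize (Sum.elim default xs) ≤ papp (PVFun.bound (symT t)) xs := by
    rw [← PV1.papp_symT hD]; exact PV1.papp_le_bound hM _ xs
  refine PV1.pairF_le_pairBoundSym hM _ _ xs (hw.trans ?_) hy hBt
  rw [PV1.papp_comp hD]
  refine PV1.papp_mono hM hT₁ fun i => ?_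
  cases i using Fin.lastCases with
  | last => simpa using hy.trans hBt
  | cast i => simp [PV1.papp_proj hD]

/-- **`∃ y ≤ t` over `Σ` is `Σ`** (witness `⟨w, y⟩_t`). [cite: Buss1986, §2.7] -/
theorem HasSigmaFormPV.bexLE (t : Language.pv.Term (Empty ⊕ Fin n)) {A : ModelPredPV (n + 1)}
    (hA : HasSigmaFormPV A) :
    HasSigmaFormPV fun K _ xs => ∃ a : K, MLe a (t.realize (Sum.elim default xs)) ∧
      A K (Fin.snoc xs a) := by
  obtain ⟨E₁, T₁, hE₁, hT₁, s₁, c₁⟩ := hA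
  let lo : Language.pv.Term (Empty ⊕ Fin (n + 1)) := lowT (liftT1 t)
  let hi : Language.pv.Term (Empty ⊕ Fin (n + 1)) := mspT (liftT1 t)
  let E : Language.pv.BoundedFormula Empty (n + 1) :=
    Term.le lo (liftT1 t) ⊓ (Term.le hi (Term.func T₁ (Fin.snoc (fun i => cv (Fin.castSucc i)) lo)) ⊓
      substCtx E₁ (Fin.snoc (Fin.snoc (fun i => cv (Fin.castSucc i)) lo) hi))
  have hE : E.IsQF :=
    (IsAtomic.rel _ _).isQF.inf ((IsAtomic.rel _ _).isQF.inf (isQF_substCtx hE₁ _))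
  refine ⟨E, bexBoundSym t T₁, hE, isMono_bexBoundSym t hT₁,
    fun K _ hK xs p _ h => ?_, fun K _ hK hsat xs hex => ?_⟩
  · haveI : K ⊨ BASIC := model_BASIC_of_model_PV1 hK
    simp only [E, lo, hi, realize_inf, realize_pvle, realize_lowT, realize_mspT, realize_liftT1,
      realize_substCtx, realize_snocCtx2', Term.realize, QSym.realize_snoc_terms] at h
    obtain ⟨hlo, hhi, hE1⟩ := h
    simp only [Sum.elim_inr, Fin.snoc_castSucc] at hhi
    exact ⟨_, (mLe_iff _ _).2 hlo, s₁ K hK _ _ ((mLe_iff _ _).2 hhi) hE1⟩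
  · haveI : K ⊨ BASIC := model_BASIC_of_model_PV1 hK
    obtain ⟨y, hy, hAy⟩ := hex
    obtain ⟨w, hw, hEw⟩ := c₁ K hK hsat _ hAy
    rw [mLe_iff] at hy hw
    refine ⟨papp PVFun.pairF ![w, y, t.realize (Sum.elim default xs)],
      (mLe_iff _ _).2 (PV1.pairF_le_bexBoundSym hK t hT₁ xs hy hw), ?_⟩
    simp only [E, lo, hi, realize_inf, realize_pvle, realize_lowT, realize_mspT, realize_liftT1,
      realize_substCtx, realize_snocCtx2', Term.realize, QSym.realize_snoc_terms, Sum.elim_inr,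
      Fin.snoc_castSucc, PV1.low_pair hK _ hy, PV1.msp_pair hK _ hy]
    exact ⟨hy, hw, hEw⟩

/-- **`∀ y ≤ t` over `Π` is `Π`**. [cite: Buss1986, §2.7] -/
theorem HasPiFormPV.ballLE (t : Language.pv.Term (Empty ⊕ Fin n)) {A : ModelPredPV (n + 1)}
    (hA : HasPiFormPV A) :
    HasPiFormPV fun K _ xs => ∀ a : K, MLe a (t.realize (Sum.elim default xs)) →
      A K (Fin.snoc xs a) := by
  obtain ⟨U₁, T₁, hU₁, hT₁, s₁, c₁⟩ := hA
  let lo : Language.pv.Term (Empty ⊕ Fin (n + 1)) := lowT (liftT1 t)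
  let hi : Language.pv.Term (Empty ⊕ Fin (n + 1)) := mspT (liftT1 t)
  let U : Language.pv.BoundedFormula Empty (n + 1) :=
    Term.le lo (liftT1 t) ⟹ (Term.le hi (Term.func T₁ (Fin.snoc (fun i => cv (Fin.castSucc i)) lo)) ⟹
      substCtx U₁ (Fin.snoc (Fin.snoc (fun i => cv (Fin.castSucc i)) lo) hi))
  have hU : U.IsQF :=
    (IsAtomic.rel _ _).isQF.imp ((IsAtomic.rel _ _).isQF.imp (isQF_substCtx hU₁ _))
  refine ⟨U, bexBoundSym t T₁, hU, isMono_bexBoundSym t hT₁,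
    fun K _ hK xs hall p _ => ?_, fun K _ hK hsat xs h a ha => ?_⟩
  · haveI : K ⊨ BASIC := model_BASIC_of_model_PV1 hK
    simp only [U, lo, hi, realize_imp, realize_pvle, realize_lowT, realize_mspT, realize_liftT1,
      realize_substCtx, realize_snocCtx2', Term.realize, QSym.realize_snoc_terms, Sum.elim_inr,
      Fin.snoc_castSucc]
    intro hlo hhi
    exact s₁ K hK _ (hall _ ((mLe_iff _ _).2 hlo)) _ ((mLe_iff _ _).2 hhi)
  · haveI : K ⊨ BASIC := model_BASIC_of_model_PV1 hK
    rw [mLe_iff] at ha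
    refine c₁ K hK hsat _ fun w hw => ?_
    rw [mLe_iff] at hw
    have hv := h (papp PVFun.pairF ![w, a, t.realize (Sum.elim default xs)])
      ((mLe_iff _ _).2 (PV1.pairF_le_bexBoundSym hK t hT₁ xs ha hw))
    simp only [U, lo, hi, realize_imp, realize_pvle, realize_lowT, realize_mspT, realize_liftT1,
      realize_substCtx, realize_snocCtx2', Term.realize, QSym.realize_snoc_terms, Sum.elim_inr,
      Fin.snoc_castSucc, PV1.low_pair hK _ ha, PV1.msp_pair hK _ ha] at hv
    exact hv ha hw

/-! ### Sharply bounded quantifiers: collection by Skolem symbols and tables -/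

/-- **Collection in an Herbrand-saturated model of `PV₁`.** If `K ⊨ ∀ z ∃ w Θ(x̄, z, w)` with `Θ`
open, and the `Θ`-witnesses at `z ≤ |s|` are `≤ B`, then one `W < (s₁ s) # B` has entries
`entry' (W, z, B, s)` which are `Θ`-witnesses for all `z ≤ |s|` (a Skolem symbol,
`PV1.exists_skolem_sym_ctx₁`, tabulated by `PV1.exists_table`) — sharply bounded collection
`BB` for open formulas (Buss 1986, §2.7; Krajíček 1995, proof of Thm. 7.6.3).
[cite: Krajicek1995, Thm. 7.6.3] -/
theorem PV1.exists_table_of_forall_exists [K ⊨ BASIC] (hM : K ⊨ PV1)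
    (hsat : IsHerbrandSaturated Language.pv K) {Θ : Language.pv.BoundedFormula Empty (n + 2)}
    (hΘ : Θ.IsQF) (xs : Fin n → K) (B s : K)
    (h : ∀ z : K, ∃ w : K, Θ.Realize default (Fin.snoc (Fin.snoc xs z) w))
    (hB : ∀ z w : K, z ≤ mLen s → Θ.Realize default (Fin.snoc (Fin.snoc xs z) w) → w ≤ B) :
    ∃ W : K, W < mSmash (pbit true s) B ∧ ∀ z : K, z ≤ mLen s →
      Θ.Realize default (Fin.snoc (Fin.snoc xs z) (papp PVFun.entry' ![W, z, B, s])) := by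
  obtain ⟨q, c, G, hG⟩ := PV1.exists_skolem_sym_ctx₁ hM hsat hΘ xs h
  obtain ⟨W, hW, hent⟩ := PV1.exists_table hM G c B s fun z hz => hB z _ hz (hG z)
  exact ⟨W, hW, fun z hz => by rw [hent z hz]; exact hG z⟩

/-- The entry-bound symbol of the sharply bounded quantifier cases: `x̄ ↦ T₁(x̄, |Bt x̄|)` with
`Bt = bound (symT t)`. [folklore] -/
def bbEntryBound (t : Language.pv.Term (Empty ⊕ Fin n)) (T₁ : PVFun (n + 1)) : PVFun n :=
  PVFun.comp T₁ (Fin.snoc (fun i => PVFun.proj i)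
    (PVFun.comp PVFun.len ![PVFun.bound (symT t)]))

/-- The table-bound symbol: `x̄ ↦ (s₁ (Bt x̄)) # (bbEntryBound x̄)`. [folklore] -/
def bbBound (t : Language.pv.Term (Empty ⊕ Fin n)) (T₁ : PVFun (n + 1)) : PVFun n :=
  PVFun.comp PVFun.smash ![PVFun.comp (PVFun.bit true) ![PVFun.bound (symT t)], bbEntryBound t T₁]

/-- `bbEntryBound` is monotone. [folklore] -/
theorem isMono_bbEntryBound (t : Language.pv.Term (Empty ⊕ Fin n)) {T₁ : PVFun (n + 1)}
    (hT₁ : T₁.IsMono) : (bbEntryBound t T₁).IsMono :=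
  hT₁.snocComp (PVFun.IsMono.comp PVFun.IsMono.len fun i => by
    fin_cases i; exact PVFun.isMono_bound _)

/-- `bbBound` is monotone. [folklore] -/
theorem isMono_bbBound (t : Language.pv.Term (Empty ⊕ Fin n)) {T₁ : PVFun (n + 1)}
    (hT₁ : T₁.IsMono) : (bbBound t T₁).IsMono :=
  PVFun.IsMono.comp PVFun.IsMono.smash fun i => by
    fin_cases i
    · exact PVFun.IsMono.comp (PVFun.IsMono.bit true) fun j => by
        fin_cases j; exact PVFun.isMono_bound _
    · exact isMono_bbEntryBound t hT₁

/-- Semantics of `bbEntryBound`. [folklore] -/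
theorem PV1.papp_bbEntryBound [K ⊨ BASIC] (hD : K ⊨ PVdef) (t : Language.pv.Term (Empty ⊕ Fin n))
    (T₁ : PVFun (n + 1)) (xs : Fin n → K) :
    papp (bbEntryBound t T₁) xs = papp T₁ (Fin.snoc xs (mLen (papp (PVFun.bound (symT t)) xs))) := by
  rw [bbEntryBound, PV1.papp_comp hD]; congr 1; funext i
  cases i using Fin.lastCases with
  | last =>
    simp only [Fin.snoc_last, PV1.papp_comp hD]
    rw [← papp_len]; congr 1; funext j; fin_cases j; rfl
  | cast i => simp [PV1.papp_proj hD]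

/-- Semantics of `bbBound`. [folklore] -/
theorem PV1.papp_bbBound [K ⊨ BASIC] (hD : K ⊨ PVdef) (t : Language.pv.Term (Empty ⊕ Fin n))
    (T₁ : PVFun (n + 1)) (xs : Fin n → K) :
    papp (bbBound t T₁) xs =
      mSmash (pbit true (papp (PVFun.bound (symT t)) xs)) (papp (bbEntryBound t T₁) xs) := by
  rw [bbBound, PV1.papp_comp hD, ← papp_smash]; congr 1; funext i
  fin_cases i
  · change papp (PVFun.comp (PVFun.bit true) ![PVFun.bound (symT t)]) xs =
      pbit true (papp (PVFun.bound (symT t)) xs)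
    rw [PV1.papp_comp hD]
    change papp (PVFun.bit true) (fun j => papp ((![PVFun.bound (symT t)] : Fin 1 → PVFun n) j) xs) =
      papp (PVFun.bit true) ![papp (PVFun.bound (symT t)) xs]
    congr 1; funext j; fin_cases j; rfl
  · rfl

/-- In a model of `PV₁`: witnesses below `T₁(x̄, z)` for `z ≤ |t(x̄)|` are below `bbEntryBound`,
and tables below `(s₁ t(x̄)) # bbEntryBound` are below `bbBound`. [folklore] -/
theorem PV1.bb_bounds [K ⊨ BASIC] (hM : K ⊨ PV1) (t : Language.pv.Term (Empty ⊕ Fin n))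
    {T₁ : PVFun (n + 1)} (hT₁ : T₁.IsMono) (xs : Fin n → K) :
    (∀ z : K, z ≤ mLen (t.realize (Sum.elim default xs)) →
      papp T₁ (Fin.snoc xs z) ≤ papp (bbEntryBound t T₁) xs) ∧
    mSmash (pbit true (t.realize (Sum.elim default xs))) (papp (bbEntryBound t T₁) xs) ≤
      papp (bbBound t T₁) xs := by
  have hD := model_PVdef_of_model_PV1 hM
  have hBt : t.realize (Sum.elim default xs) ≤ papp (PVFun.bound (symT t)) xs := by
    rw [← PV1.papp_symT hD]; exact PV1.papp_le_bound hM _ xs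
  refine ⟨fun z hz => ?_, ?_⟩
  · rw [PV1.papp_bbEntryBound hD]
    refine PV1.papp_mono hM hT₁ fun i => ?_
    cases i using Fin.lastCases with
    | last => simpa using hz.trans (mLen_le_mLen hBt)
    | cast i => simp
  · rw [PV1.papp_bbBound hD]
    refine PV1.mSmash_le_mSmash_left hM ?_ _
    rcases hBt.lt_or_eq with hlt | heq
    · exact ((PV1.pbit_lt_pbit_iff hD true true _ _).2 (Or.inl hlt)).le
    · rw [heq]

/-- The table-entry term `entry' (W, z, Bw, t)` in the context `(x̄, W, z)`. [folklore] -/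
def bbEntryT (t : Language.pv.Term (Empty ⊕ Fin n)) (T₁ : PVFun (n + 1)) :
    Language.pv.Term (Empty ⊕ Fin (n + 2)) :=
  Term.func PVFun.entry' ![cv (Fin.castSucc (Fin.last n)), cv (Fin.last (n + 1)),
    upSym2 (bbEntryBound t T₁), liftT2 t]

/-- The substitution `(x̄, z, w) ↦ (x̄, z, entry-term)` from the context `(x̄, z, w)` of the inner
form into the context `(x̄, W, z)`. [folklore] -/
def bbSubst (t : Language.pv.Term (Empty ⊕ Fin n)) (T₁ : PVFun (n + 1)) :
    Fin (n + 2) → Language.pv.Term (Empty ⊕ Fin (n + 2)) :=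
  Fin.snoc (Fin.snoc (fun i => cv (Fin.castSucc (Fin.castSucc i))) (cv (Fin.last (n + 1))))
    (bbEntryT t T₁)

/-- Semantics of `bbEntryT`. [folklore] -/
theorem realize_bbEntryT (t : Language.pv.Term (Empty ⊕ Fin n)) (T₁ : PVFun (n + 1))
    (xs : Fin n → K) (W z : K) :
    (bbEntryT t T₁).realize (Sum.elim default (Fin.snoc (Fin.snoc xs W) z)) =
      papp PVFun.entry' ![W, z, papp (bbEntryBound t T₁) xs, t.realize (Sum.elim default xs)] := by
  rw [bbEntryT, QSym.realize_func_vec4]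
  simp

/-- Semantics of `bbSubst`. [folklore] -/
theorem realize_bbSubst (t : Language.pv.Term (Empty ⊕ Fin n)) (T₁ : PVFun (n + 1))
    (xs : Fin n → K) (W z : K) :
    (fun i => (bbSubst t T₁ i).realize (Sum.elim default (Fin.snoc (Fin.snoc xs W) z))) =
      Fin.snoc (Fin.snoc xs z)
        (papp PVFun.entry' ![W, z, papp (bbEntryBound t T₁) xs, t.realize (Sum.elim default xs)]) := by
  funext i
  cases i using Fin.lastCases with
  | last => simp [bbSubst, realize_bbEntryT]
  | cast i =>
    cases i using Fin.lastCases with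
    | last => simp [bbSubst]
    | cast i => simp [bbSubst]

/-- The bounding term `T₁(x̄, z)` in the context `(x̄, W, z)`. [folklore] -/
def bbT₁T (T₁ : PVFun (n + 1)) : Language.pv.Term (Empty ⊕ Fin (n + 2)) :=
  Term.func T₁ (Fin.snoc (fun i => cv (Fin.castSucc (Fin.castSucc i))) (cv (Fin.last (n + 1))))

/-- Semantics of `bbT₁T`. [folklore] -/
theorem realize_bbT₁T (T₁ : PVFun (n + 1)) (xs : Fin n → K) (W z : K) :
    (bbT₁T T₁).realize (Sum.elim default (Fin.snoc (Fin.snoc xs W) z)) = papp T₁ (Fin.snoc xs z) := by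
  rw [bbT₁T, Term.realize, QSym.realize_snoc_terms]
  simp

/-- The Skolemization matrix `z ≤ |t| → (w ≤ T₁(x̄,z) ∧ Φ(x̄,z,w))` in the context `(x̄, z, w)`.
[folklore] -/
def bbTheta (t : Language.pv.Term (Empty ⊕ Fin n)) (T₁ : PVFun (n + 1))
    (Φ : Language.pv.BoundedFormula Empty (n + 2)) : Language.pv.BoundedFormula Empty (n + 2) :=
  Term.le (cv (Fin.castSucc (Fin.last n))) (pvLen (liftT2 t)) ⟹
    (Term.le (cv (Fin.last (n + 1)))
      (Term.func T₁ (Fin.snoc (fun i => cv (Fin.castSucc (Fin.castSucc i)))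
        (cv (Fin.castSucc (Fin.last n))))) ⊓ Φ)

/-- `bbTheta` is open for open `Φ`. [folklore] -/
theorem isQF_bbTheta (t : Language.pv.Term (Empty ⊕ Fin n)) (T₁ : PVFun (n + 1))
    {Φ : Language.pv.BoundedFormula Empty (n + 2)} (hΦ : Φ.IsQF) : (bbTheta t T₁ Φ).IsQF :=
  (IsAtomic.rel _ _).isQF.imp ((IsAtomic.rel _ _).isQF.inf hΦ)

/-- Semantics of `bbTheta`. [folklore] -/
theorem realize_bbTheta [K ⊨ BASIC] (t : Language.pv.Term (Empty ⊕ Fin n)) (T₁ : PVFun (n + 1))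
    (Φ : Language.pv.BoundedFormula Empty (n + 2)) (xs : Fin n → K) (z w : K) :
    (bbTheta t T₁ Φ).Realize default (Fin.snoc (Fin.snoc xs z) w) ↔
      (z ≤ mLen (t.realize (Sum.elim default xs)) →
        w ≤ papp T₁ (Fin.snoc xs z) ∧ Φ.Realize default (Fin.snoc (Fin.snoc xs z) w)) := by
  simp only [bbTheta, realize_imp, realize_inf, realize_pvle, realize_pvLen', realize_liftT2,
    Term.realize, QSym.realize_snoc_terms]
  simp

/-- **`∀ z ≤ |t|` over `Σ` is `Σ`** over `PV₁`: the witness is a table of witnesses, which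
exists in Herbrand-saturated models of `PV₁` by collection (`PV1.exists_table_of_forall_exists`);
the table predicate is open by `HasOpenFormPV.ballLELen` (Buss 1986, §2.7: `BB Σᵇ₁`;
Krajíček 1995, proof of Thm. 7.6.3). [cite: Buss1986, §2.7] -/
theorem HasSigmaFormPV.ballLELen (t : Language.pv.Term (Empty ⊕ Fin n)) {A : ModelPredPV (n + 1)}
    (hA : HasSigmaFormPV A) :
    HasSigmaFormPV fun K _ xs => ∀ a : K, MLe a (mLen (t.realize (Sum.elim default xs))) →
      A K (Fin.snoc xs a) := by
  obtain ⟨E₁, T₁, hE₁, hT₁, s₁, c₁⟩ := hA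
  -- the table matrix `Mx(x̄, W, z)`: the entry is a witness at `z`
  let Mx : Language.pv.BoundedFormula Empty (n + 2) :=
    Term.le (bbEntryT t T₁) (bbT₁T T₁) ⊓ substCtx E₁ (bbSubst t T₁)
  have hMx : Mx.IsQF := (IsAtomic.rel _ _).isQF.inf (isQF_substCtx hE₁ _)
  have hsem : ∀ (K : Type) [Language.pv.Structure K], K ⊨ PV1 → ∀ (xs : Fin n → K) (W z : K),
      Mx.Realize default (Fin.snoc (Fin.snoc xs W) z) ↔
        (MLe (papp PVFun.entry' ![W, z, papp (bbEntryBound t T₁) xs, t.realize (Sum.elim default xs)])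
          (papp T₁ (Fin.snoc xs z)) ∧
        E₁.Realize default (Fin.snoc (Fin.snoc xs z)
          (papp PVFun.entry' ![W, z, papp (bbEntryBound t T₁) xs, t.realize (Sum.elim default xs)]))) := by
    intro K _ hK xs W z
    haveI : K ⊨ BASIC := model_BASIC_of_model_PV1 hK
    simp only [Mx, realize_inf, realize_pvle, realize_bbEntryT, realize_bbT₁T, realize_substCtx,
      realize_bbSubst, mLe_iff]
  obtain ⟨π, hπ, eπ⟩ := (hasOpenFormPV_of_isQF hMx).ballLELen (liftT1 t)
  refine ⟨π, bbBound t T₁, hπ, isMono_bbBound t hT₁, fun K _ hK xs W _ hW a ha => ?_,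
    fun K _ hK hsat xs hall => ?_⟩
  · -- soundness: every entry of the table is a witness
    haveI : K ⊨ BASIC := model_BASIC_of_model_PV1 hK
    have h1 := (eπ K hK (Fin.snoc xs W)).2 hW
    dsimp only at h1
    rw [realize_liftT1] at h1
    have h2 := (hsem K hK xs W a).1 (h1 a ha)
    exact s₁ K hK (Fin.snoc xs a) _ h2.1 h2.2
  · -- completeness: collect the witnesses into a table
    haveI : K ⊨ BASIC := model_BASIC_of_model_PV1 hK
    have hD := model_PVdef_of_model_PV1 hK
    set sv : K := t.realize (Sum.elim default xs) with hsv
    obtain ⟨hbw, hbb⟩ := PV1.bb_bounds hK t hT₁ xs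
    have hex : ∀ z : K, ∃ w : K, (bbTheta t T₁ E₁).Realize default (Fin.snoc (Fin.snoc xs z) w) := by
      intro z
      by_cases hz : z ≤ mLen sv
      · obtain ⟨w, hw, hEw⟩ := c₁ K hK hsat (Fin.snoc xs z) (hall z ((mLe_iff _ _).2 hz))
        exact ⟨w, (realize_bbTheta t T₁ E₁ xs z w).2 fun _ => ⟨(mLe_iff _ _).1 hw, hEw⟩⟩
      · exact ⟨0, (realize_bbTheta t T₁ E₁ xs z 0).2 fun h => absurd h hz⟩
    obtain ⟨W, hW, hent⟩ := PV1.exists_table_of_forall_exists hK hsat (isQF_bbTheta t T₁ hE₁) xs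
      (papp (bbEntryBound t T₁) xs) sv hex fun z w hz hΘ =>
        ((realize_bbTheta t T₁ E₁ xs z w).1 hΘ hz).1.trans (hbw z hz)
    refine ⟨W, (mLe_iff _ _).2 (hW.le.trans hbb), (eπ K hK (Fin.snoc xs W)).1 ?_⟩
    dsimp only
    rw [realize_liftT1]
    intro a ha
    rw [mLe_iff] at ha
    have hΘ := (realize_bbTheta t T₁ E₁ xs a _).1 (hent a ha) ha
    exact (hsem K hK xs W a).2 ⟨(mLe_iff _ _).2 hΘ.1, hΘ.2⟩

/-- **`∃ z ≤ |t|` over `Π` is `Π`** over `PV₁` (dual of `HasSigmaFormPV.ballLELen`: a table of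
counter-witnesses refutes the universal form). [cite: Buss1986, §2.7] -/
theorem HasPiFormPV.bexLELen (t : Language.pv.Term (Empty ⊕ Fin n)) {A : ModelPredPV (n + 1)}
    (hA : HasPiFormPV A) :
    HasPiFormPV fun K _ xs => ∃ a : K, MLe a (mLen (t.realize (Sum.elim default xs))) ∧
      A K (Fin.snoc xs a) := by
  obtain ⟨U₁, T₁, hU₁, hT₁, s₁, c₁⟩ := hA
  let Nx : Language.pv.BoundedFormula Empty (n + 2) :=
    Term.le (bbEntryT t T₁) (bbT₁T T₁) ⟹ substCtx U₁ (bbSubst t T₁)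
  have hNx : Nx.IsQF := (IsAtomic.rel _ _).isQF.imp (isQF_substCtx hU₁ _)
  have hsem : ∀ (K : Type) [Language.pv.Structure K], K ⊨ PV1 → ∀ (xs : Fin n → K) (W z : K),
      Nx.Realize default (Fin.snoc (Fin.snoc xs W) z) ↔
        (MLe (papp PVFun.entry' ![W, z, papp (bbEntryBound t T₁) xs, t.realize (Sum.elim default xs)])
          (papp T₁ (Fin.snoc xs z)) →
        U₁.Realize default (Fin.snoc (Fin.snoc xs z)
          (papp PVFun.entry' ![W, z, papp (bbEntryBound t T₁) xs, t.realize (Sum.elim default xs)]))) := by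
    intro K _ hK xs W z
    haveI : K ⊨ BASIC := model_BASIC_of_model_PV1 hK
    simp only [Nx, realize_imp, realize_pvle, realize_bbEntryT, realize_bbT₁T, realize_substCtx,
      realize_bbSubst, mLe_iff]
  obtain ⟨π, hπ, eπ⟩ := (hasOpenFormPV_of_isQF hNx).bexLELen (liftT1 t)
  refine ⟨π, bbBound t T₁, hπ, isMono_bbBound t hT₁, fun K _ hK xs hex W _ => ?_,
    fun K _ hK hsat xs hall => ?_⟩
  · -- soundness
    haveI : K ⊨ BASIC := model_BASIC_of_model_PV1 hK
    obtain ⟨a, ha, hAa⟩ := hex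
    refine (eπ K hK (Fin.snoc xs W)).1 ?_
    dsimp only
    rw [realize_liftT1]
    exact ⟨a, ha, (hsem K hK xs W a).2 fun hle => s₁ K hK (Fin.snoc xs a) hAa _ hle⟩
  · -- completeness, by contradiction: a table of counter-witnesses
    haveI : K ⊨ BASIC := model_BASIC_of_model_PV1 hK
    have hD := model_PVdef_of_model_PV1 hK
    by_contra hno
    push Not at hno
    set sv : K := t.realize (Sum.elim default xs) with hsv
    obtain ⟨hbw, hbb⟩ := PV1.bb_bounds hK t hT₁ xs
    have hex : ∀ z : K, ∃ w : K, (bbTheta t T₁ (∼U₁)).Realize default (Fin.snoc (Fin.snoc xs z) w) := by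
      intro z
      by_cases hz : z ≤ mLen sv
      · have hnA : ¬ A K (Fin.snoc xs z) := hno z ((mLe_iff _ _).2 hz)
        have hnall : ¬ ∀ w : K, MLe w (papp T₁ (Fin.snoc xs z)) →
            U₁.Realize default (Fin.snoc (Fin.snoc xs z) w) := fun h => hnA (c₁ K hK hsat _ h)
        push Not at hnall
        obtain ⟨w, hw, hUw⟩ := hnall
        refine ⟨w, (realize_bbTheta t T₁ (∼U₁) xs z w).2 fun _ => ⟨(mLe_iff _ _).1 hw, ?_⟩⟩
        rw [realize_not]; exact hUw
      · exact ⟨0, (realize_bbTheta t T₁ (∼U₁) xs z 0).2 fun h => absurd h hz⟩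
    obtain ⟨W, hW, hent⟩ := PV1.exists_table_of_forall_exists hK hsat
      (isQF_bbTheta t T₁ hU₁.not) xs (papp (bbEntryBound t T₁) xs) sv hex fun z w hz hΘ =>
        ((realize_bbTheta t T₁ (∼U₁) xs z w).1 hΘ hz).1.trans (hbw z hz)
    have hU := (eπ K hK (Fin.snoc xs W)).2 (hall W ((mLe_iff _ _).2 (hW.le.trans hbb)))
    dsimp only at hU
    rw [realize_liftT1] at hU
    obtain ⟨a, ha, hNa⟩ := hU
    rw [mLe_iff] at ha
    have hΘ := (realize_bbTheta t T₁ (∼U₁) xs a _).1 (hent a ha) ha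
    rw [realize_not] at hΘ
    exact hΘ.2 ((hsem K hK xs W a).1 hNa ((mLe_iff _ _).2 hΘ.1))

/-! ### The simultaneous induction -/

/-- `Πᵇ₀(PV)` formulas are sharply bounded. [cite: Buss1986, Ch. 6] -/
theorem isSharplyBoundedPV_of_isPibPV_zero {α : Type} {m : ℕ} {φ : Language.pv.BoundedFormula α m}
    (h : IsPibPV 0 φ) : IsSharplyBoundedPV φ := by
  cases h; assumption

/-- **Witness forms of `Σᵇ₁(PV)` and `Πᵇ₁(PV)` formulas over `PV₁`.** Every `Σᵇ₁(PV)` formula in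
context variables has a `Σ` form and every `Πᵇ₁(PV)` formula a `Π` form, sound in all models of
`PV₁` and complete in the Herbrand-saturated ones — simultaneous induction on the generation of
the classes (Buss 1986, §2.7 and Ch. 6; Krajíček 1995, Lemma 7.2.2 and proof of Thm. 7.6.3).
[cite: Krajicek1995, Lemma 7.2.2] -/
theorem hasForms_of_isSigmabPV_of_isPibPV (i : ℕ) :
    (∀ {m : ℕ} {θ : Language.pv.BoundedFormula Empty m}, IsSigmabPV i θ →
      (i = 1 → HasSigmaFormPV (predOfPV θ))) ∧
    (∀ {m : ℕ} {θ : Language.pv.BoundedFormula Empty m}, IsPibPV i θ →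
      (i = 1 → HasPiFormPV (predOfPV θ))) := by
  constructor
  · intro m θ h
    refine IsSigmabPV.rec
      (motive_1 := fun i m θ _ => i = 1 → HasSigmaFormPV (predOfPV θ))
      (motive_2 := fun i m θ _ => i = 1 → HasPiFormPV (predOfPV θ))
      ?_ ?_ ?_ ?_ ?_ ?_ ?_ ?_ ?_ ?_ h
    all_goals intros
    · exact (hasOpenFormPV_of_isSharplyBoundedPV ‹_›).hasSigmaFormPV
    · rename_i i n φ hφ ih h1
      cases h1
      exact (hasOpenFormPV_of_isSharplyBoundedPV (isSharplyBoundedPV_of_isPibPV_zero hφ)).hasSigmaFormPV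
    · rename_i i n φ ψ hφ hψ ih₁ ih₂ h1
      exact ((ih₁ h1).imp_sigma (ih₂ h1)).of_iff fun K _ hK xs => by simp [predOfPV]
    · rename_i i n t φ hφ ih h1
      exact ((ih h1).bexLE t).of_iff fun K _ hK xs => by simp [predOfPV]
    · rename_i i n t φ hφ ih h1
      exact ((ih h1).ballLELen t).of_iff fun K _ hK xs => by
        simp only [predOfPV, ballLELenPV, realize_ballLE_pv', realize_pvLen']
    · exact (hasOpenFormPV_of_isSharplyBoundedPV ‹_›).hasPiFormPV
    · rename_i i n φ hφ ih h1
      cases h1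
      exact (hasOpenFormPV_of_isSharplyBoundedPV
        ((IsSharplyBoundedPV.isSigmabPV_zero).1 hφ)).hasPiFormPV
    · rename_i i n φ ψ hφ hψ ih₁ ih₂ h1
      exact ((ih₁ h1).imp_pi (ih₂ h1)).of_iff fun K _ hK xs => by simp [predOfPV]
    · rename_i i n t φ hφ ih h1
      exact ((ih h1).ballLE t).of_iff fun K _ hK xs => by simp [predOfPV]
    · rename_i i n t φ hφ ih h1
      exact ((ih h1).bexLELen t).of_iff fun K _ hK xs => by
        simp only [predOfPV, bexLELenPV, realize_bexLE_pv', realize_pvLen']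
  · intro m θ h
    refine IsPibPV.rec
      (motive_1 := fun i m θ _ => i = 1 → HasSigmaFormPV (predOfPV θ))
      (motive_2 := fun i m θ _ => i = 1 → HasPiFormPV (predOfPV θ))
      ?_ ?_ ?_ ?_ ?_ ?_ ?_ ?_ ?_ ?_ h
    all_goals intros
    · exact (hasOpenFormPV_of_isSharplyBoundedPV ‹_›).hasSigmaFormPV
    · rename_i i n φ hφ ih h1
      cases h1
      exact (hasOpenFormPV_of_isSharplyBoundedPV (isSharplyBoundedPV_of_isPibPV_zero hφ)).hasSigmaFormPV
    · rename_i i n φ ψ hφ hψ ih₁ ih₂ h1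
      exact ((ih₁ h1).imp_sigma (ih₂ h1)).of_iff fun K _ hK xs => by simp [predOfPV]
    · rename_i i n t φ hφ ih h1
      exact ((ih h1).bexLE t).of_iff fun K _ hK xs => by simp [predOfPV]
    · rename_i i n t φ hφ ih h1
      exact ((ih h1).ballLELen t).of_iff fun K _ hK xs => by
        simp only [predOfPV, ballLELenPV, realize_ballLE_pv', realize_pvLen']
    · exact (hasOpenFormPV_of_isSharplyBoundedPV ‹_›).hasPiFormPV
    · rename_i i n φ hφ ih h1
      cases h1
      exact (hasOpenFormPV_of_isSharplyBoundedPV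
        ((IsSharplyBoundedPV.isSigmabPV_zero).1 hφ)).hasPiFormPV
    · rename_i i n φ ψ hφ hψ ih₁ ih₂ h1
      exact ((ih₁ h1).imp_pi (ih₂ h1)).of_iff fun K _ hK xs => by simp [predOfPV]
    · rename_i i n t φ hφ ih h1
      exact ((ih h1).ballLE t).of_iff fun K _ hK xs => by simp [predOfPV]
    · rename_i i n t φ hφ ih h1
      exact ((ih h1).bexLELen t).of_iff fun K _ hK xs => by
        simp only [predOfPV, bexLELenPV, realize_bexLE_pv', realize_pvLen']

/-- **Every `Σᵇ₁(PV)` formula has a witness form over `PV₁`.** [cite: Krajicek1995, Lemma 7.2.2] -/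
theorem hasSigmaFormPV_of_isSigmabPV_one {θ : Language.pv.BoundedFormula Empty n}
    (h : IsSigmabPV 1 θ) : HasSigmaFormPV (predOfPV θ) :=
  (hasForms_of_isSigmabPV_of_isPibPV 1).1 h rfl

/-- **Every `Πᵇ₁(PV)` formula has a counter-witness form over `PV₁`.** [cite: Krajicek1995, Lemma 7.2.2] -/
theorem hasPiFormPV_of_isPibPV_one {θ : Language.pv.BoundedFormula Empty n}
    (h : IsPibPV 1 θ) : HasPiFormPV (predOfPV θ) :=
  (hasForms_of_isSigmabPV_of_isPibPV 1).2 h rfl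

end Forms

end Literature.Analysis.FunctionSpaces
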